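/-
Copyright (c) 2026 the pub-hodgecm-mathlib formalisation cell (harness21).  Prover seat hodgecm-mathlib-LH3-p03 (g6): LH3 «Transf» road, letter L3′ forward half,
brick (JH-asm) (dealer LH3-plan (g4); spec LH3-p01 (g5) `JH-SPEC.v2.md` §3; binder of record LH3-p01 (g5)).
-/
import Literature.NumberTheory.Rogawski1990.ArchTransfFamilyJumpUnitJets        -- ★ (LH7-p02): `archERho_eq_archERho_insert_cayPt`; brings ★ p850399 `ArchTransfFamilyJumpJets` (LETTER DICTIONARY `bzAdaptedVec_eq_hcAdaptedVec ∕ bzCayVec_eq_hcCayVec ∕ bzCayScalar_eq_hcCayScalar`), ★ `ArchTransfFamilyJumpKit` (`hcCayPt_zero_two`), ★ `ArchHCSpaceG` (`hcNrm_zero_two`, `HcSemireg`, `hc…`)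
import Literature.NumberTheory.Rogawski1990.ArchBouazizJumpStOrbFamH          -- ★ p851367 (this seat) (JH-E): the consumer `exists_archBouazizSpaceH_stOrbFamH(_borel) (hsemi)`; brings ★ (π) `ArchBouazizJumpPropagation` (`contDiff_archERho`)
import Literature.NumberTheory.Rogawski1990.ArchBouazizSmoothBoundedGeneral   -- ★ p851279: frame of `stOrbFamH`, `ArchSmooth₂`
import Literature.NumberTheory.Rogawski1990.ArchHcJumpTwoChartOrbitalStable   -- ★ (st-2) p851397 (LH3-p01 (g5)): `hasOneSidedJump_iteratedFDeriv_adaptedWord_of_twoChart_orbital_stable`; brings ★ 2b p851048, ★ p851143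
import Literature.NumberTheory.Automorphic.ArchRankOneJumpAllOrdersChartStable -- ★ (st-1) p851391 (LH3-p01 (g5)): `exists_hasOneSidedJump_iteratedDeriv_allOrders_chart_stable_of_eq_over`
import HarnessLib

/-!
# (JH-asm) THE (J)-H CLAUSE AT THE `G`-SEMIREGULAR WALL POINTS FROM A TWO-CHART DESCENT PACKAGE — ONE CONSTANT BEFORE THE TEST FUNCTION
# (Harish-Chandra's jump relations for `U(1,1)`; Shelstad 1979 Lemma 4.3, Prop. 4.5, Thm. 4.7 (IIIb); Bouaziz 1994 §3.2 (I₃), §6.2; Varadarajan 1977 I §1.12)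

Topic `NumberTheory/Rogawski1990`; namespace `Literature.NumberTheory.Rogawski1990`.  THEOREMS ONLY (no `def`, no instance, no notation, no axiom, no named fact, no `sorry`);
kernel lane `--kind proof --supports stmt-HodgeConjecture-24833`.  Cell `pub/hodgecm-mathlib`, crux H413 (`stmt-HodgeConjecture-24833`), F0∕P3c line LH3 (closer stub `stub_N9`,
leaf `F0_P3c_StubN9Direct`), letter L3′ `stub_N9bouazizSurjective` FORWARD HALF, road (J)-H v2 (LH3-p01 (g5) `JH-SPEC.v2.md`), brick **(JH-asm)** (LH3-p03 (g6); dealer LH3-plan (g4),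
binder of record LH3-p01 (g5)).  Consumer: ★ p851367 `exists_archBouazizSpaceH_stOrbFamH(_borel) (hsemi)` — this file PAYS the body of its socket `hsemi` at one wall `(S, w₀)` from
a two-chart descent package ((JH-desc), LH3-p01) over fH-free rank-one data ((JH-A) LH10-p02, (JH-A′)).

§0 LETTER DICTIONARY at the pair `(0, 2)` (the noncompact wall `θ₀ = θ₂` of the `U(1,1)_{w₀}` block) — all ★ and IMPORTED: `bzAdaptedVec_eq_hcAdaptedVec`, `bzCayVec_eq_hcCayVec`,
`bzCayScalar_eq_hcCayScalar` (★ p850399 `ArchTransfFamilyJumpJets`), `hcNrm_zero_two` (★ `ArchHCSpaceG`), `hcCayPt_zero_two` (★ `ArchTransfFamilyJumpKit`); here only: ★ (π)'s four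
`G`-semiregular hypotheses = `HcSemireg S w₀ 0 2 p` (`hcSemireg_zero_two_of_gSemireg`).
§1 TWIST DIVISION: `archERho S p = archERho (insert w₀ S) (cayPt w₀ p)` on the wall (★ `archERho_eq_archERho_insert_cayPt`), the twist is continuous (★ `contDiff_archERho`) and a unit, so a jump of
the PLAIN jets of `archERho S · Ψ S` against `archERho S′ · Ψ S′` is the same jump of Bouaziz's `bzTwistedDeriv` (`= (archERho)⁻¹ ·` plain jet) with the same constant:
**`hasOneSidedJump_bzTwistedDeriv_of_hc`** turns ★ 2b's conclusion at `(w₀, 0, 2)`, `F₁ := archERho S · Ψ S`, `F₂ := archERho S′ · Ψ S′` into the `(S, w₀, p, n, m)`-clause of ★ `ArchBzJump`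
VERBATIM.
§2 THE HEAD **`exists_jumpConst_stOrbFamH_of_twoChartDescent (L νH) (S w₀ hw₀) (hJ) (μ) (κK μN hK hKB) (Φ₁ hΦ₁) (Φ₂ hΦ₂) (Pf) (K₁ K₂ hK₁ hK₂) (hdesc) :
  ∃ Jc ≠ 0, ∀ fH, ArchSmooth₂ L fH → ∀ p, ‹(π)'s G-semiregular hypotheses› → ∀ n m, HasOneSidedJump (fun ν => bzTwistedDeriv S n (bzAdaptedVec w₀ ∘ m) (stOrbFamH L νH fH S) (p + ν • nrm w₀))
    (Jc * bzCayScalar w₀ m * bzTwistedDeriv (insert w₀ S) n (bzCayVec ∘ m) (stOrbFamH L νH fH (insert w₀ S)) (cayPt w₀ p))`** — GIVEN-form, all fH-free data as binders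
(the rank-one carrier `U(J)`, `hJ : J = Φ₂ ⊗ ℂ`, read at `J := σ_{w₀}Φ₂` so that `U(J) = archLocal L 2 Φ₂ w₀`; a two-sided Haar `μ` for the elliptic reader `Φ₁` with centre `1` in ★ 2b's
`•`-token (= (JH-desc)'s); an Iwasawa datum `(K, κK, μN)` for the split half-chart reader `Φ₂` at angle `0` in ★ 4d's token; a cofactor `Pf`; constants `K₁, K₂ ≠ 0`), ONE socket `hdesc` = the
conclusion of (JH-desc) `exists_twoChart_descent_of_representation` (LH3-p01) read at `Ψ := stOrbFamH L νH fH S`, `Ψ′ := stOrbFamH L νH fH S′` TOKEN FOR TOKEN: per `fH ∈ C_c^∞(H_∞)` and per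
semiregular wall point `p` (`HcSemireg S w₀ 0 2 p`) an admissible family `G` (jointly `C^∞`, one compact support), `Pf` smooth, the compact-chart identity
`archERho S c · stOrbFamH S c = K₁ · (1 · Pf(π c) − 0) · (Φ₁ (G (π c)) (ν c) − Φ₁ (G (π c)) (−ν c))` off the wall near `p` (`ν c = (c_{w₀0} − c_{w₀2})∕2`, `π c = c − ν c • hcNrm w₀ 0 2`; the STABLE,
odd-ised reader — Shelstad's doubling over the flips through `w₀`) and the split-chart identity `archERho S′ c″ · stOrbFamH S′ c″ = K₂ · (1 · Pf(ĉ″) − 0) · Φ₂ (G ĉ″) (x c″)` near the Cayley point (★ (st-2)'s shapes with `ce = ch := 1`, `Ef := 0`)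
(`ĉ″ = update c″ w₀ (s ↦ if s = hcThird 0 2 then c″_{w₀1} else c″_{w₀2})`).  PROOF: ★ (st-1) `exists_hasOneSidedJump_iteratedDeriv_allOrders_chart_stable_of_eq_over` gives ONE `κ₀ > 0`
with the odd-ised rank-one junction for EVERY admissible family (`jump(∂ᵃΦ₁^{st} f) = 2κ₀ Iᵃ ∂ᵃΦ₂ f (0)`); `Jc := (K₁∕K₂)·2κ₀`; per `(fH, p, n, m)`: ★ (st-2)
`hasOneSidedJump_iteratedFDeriv_adaptedWord_of_twoChart_orbital_stable` with `Q := univ`, `T₁ := {sin ≠ 0}`, `ce = ch := 1`, `Ef := 0` (Wick trivial), then §1.  HONEST LABEL: count-neutral;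
HC_CM is proved only modulo the 7 printed citations (2 remaining: hLiu418 = stmt-HodgeConjecture-24832, h413 = stmt-HodgeConjecture-24833) until rung 0 closes; this file pays `hsemi` only
once (JH-A)(JH-A′)(JH-desc) are ★ and instantiated.

## References
* [Shelstad1979] D. Shelstad, *Characters and inner forms of a quasi-split group over ℝ*, Compositio Math. 39 (1979) 11–45: §4 (II) p. 23, Lemma 4.3 p. 25, Prop. 4.5 p. 26, Thm. 4.7 (IIIb) p. 31.
* [Bouaziz1994IntegralesOrbitales] A. Bouaziz, *Intégrales orbitales sur les groupes de Lie réductifs*, Ann. Sci. ÉNS (4) 27 (1994) 573–609: §3.2 (I₃) p. 580, §6.2 p. 591.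
* [Varadarajan1977] V. S. Varadarajan, *Harmonic Analysis on Real Reductive Groups*, LNM 576 (1977), Part I §1.12.
-/

set_option autoImplicit false

noncomputable section

open Set Filter Topology Function Complex Finset MeasureTheory MeasureTheory.Measure NumberField NumberField.InfinitePlace Matrix
open scoped MatrixGroups Matrix.Norms.Operator ContDiff Classical
open Literature.NumberTheory.Automorphic Literature.NumberTheory.Automorphic.UnitaryGroup
open Literature.NumberTheory.Automorphic.ArchCartan
open Literature.NumberTheory.Automorphic.Shelstad1979.StableOrbitalIntegrals

namespace Literature.NumberTheory.Rogawski1990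

section Dictionary

variable {W : Type*}

/-- **THE `G`-SEMIREGULAR CLAUSE OF ★ (π) IS `HcSemireg S w₀ 0 2`** (on the wall, third eigenvalue `e^{i p_{w₀1}}` off, three distinct eigenvalues at the other compact places off `S`,
`x ≠ 0` on `S`). [cite: Shelstad1979, §4 p. 22] -/
theorem hcSemireg_zero_two_of_gSemireg (S : Finset W) (w₀ : W) {p : W → Fin 3 → ℝ} (hp02 : p w₀ 0 = p w₀ 2)
    (hp1 : Circle.exp (p w₀ 1) ≠ Circle.exp (p w₀ 0)) (hinj : ∀ v, v ∉ S → v ≠ w₀ → Function.Injective fun i : Fin 3 => Circle.exp (p v i))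
    (hx : ∀ v ∈ S, p v 0 ≠ 0) : HcSemireg S w₀ 0 2 p := by
  refine ⟨hp02, ?_, hinj, hx⟩
  rw [hcThird_zero_two]
  exact hp1

end Dictionary

section Twist

variable {W : Type*} [Fintype W] [DecidableEq W]

/-- **TWIST DIVISION**: a one-sided jump of the PLAIN jets of the twisted families `archERho S · Ψ S` (along the normal ray at a wall point `p`) against `archERho S′ · Ψ S′` (at the Cayley
point) is the same jump, with the same constant, for Bouaziz's twisted derivatives `bzTwistedDeriv` = `(archERho)⁻¹ ·` plain jet — the twist is continuous through the wall and the two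
twists agree there. [cite: Bouaziz1994IntegralesOrbitales, §6.2 p. 591] [cite: Shelstad1979, §4 pp. 24–25] -/
theorem hasOneSidedJump_bzTwistedDeriv_of_iteratedFDeriv (S : Finset W) {w₀ : W} (hw₀ : w₀ ∉ S) (Ψ : Finset W → (W → Fin 3 → ℝ) → ℂ)
    {p : W → Fin 3 → ℝ} (hp : p w₀ 0 = p w₀ 2) {n : ℕ} (dirs dirs' : Fin n → (W → Fin 3 → ℝ)) {J : ℂ}
    (h : HasOneSidedJump (fun ν : ℝ => iteratedFDeriv ℝ n (fun c => archERho S c * Ψ S c) (p + ν • nrm w₀) dirs)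
      (J * iteratedFDeriv ℝ n (fun c => archERho (insert w₀ S) c * Ψ (insert w₀ S) c) (cayPt w₀ p) dirs')) :
    HasOneSidedJump (fun ν : ℝ => bzTwistedDeriv S n dirs (Ψ S) (p + ν • nrm w₀))
      (J * bzTwistedDeriv (insert w₀ S) n dirs' (Ψ (insert w₀ S)) (cayPt w₀ p)) := by
  have hcurve : Tendsto (fun ν : ℝ => p + ν • nrm w₀) (𝓝 (0 : ℝ)) (𝓝 p) := by
    have hc : Continuous fun ν : ℝ => p + ν • nrm w₀ := continuous_const.add (continuous_id.smul continuous_const)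
    simpa only [zero_smul, add_zero] using hc.tendsto 0
  have hEρ : Tendsto (fun ν : ℝ => (archERho S (p + ν • nrm w₀))⁻¹) (𝓝 (0 : ℝ)) (𝓝 (archERho S p)⁻¹) :=
    ((((contDiff_archERho S).continuous).tendsto p).comp hcurve).inv₀ (archERho_ne_zero S p)
  obtain ⟨Lp, Lm, hLp, hLm, hJ⟩ := h
  refine ⟨(archERho S p)⁻¹ * Lp, (archERho S p)⁻¹ * Lm, (hEρ.mono_left nhdsWithin_le_nhds).mul hLp, (hEρ.mono_left nhdsWithin_le_nhds).mul hLm, ?_⟩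
  rw [← mul_sub, hJ, bzTwistedDeriv, archERho_eq_archERho_insert_cayPt S hw₀ hp]
  ring

/-- **FROM ★ 2b's `hc`-CURRENCY TO ★ `ArchBzJump`'s `bz`-CURRENCY** (the last step of (JH-asm)): a one-sided jump of every adapted-word jet of `F₁ = archERho S · Ψ S` along `p + ν • hcNrm w₀ 0 2`
against the Cayley-word jet of `F₂ = archERho S′ · Ψ S′` at `hcCayPt w₀ 0 2 p` with constant `J · hcCayScalar w₀ 0 m` IS the `(S, w₀, p, n, m)`-clause of `ArchBzJump` with `jcH S w₀ := J`
(letter dictionary + twist division). [cite: Bouaziz1994IntegralesOrbitales, §3.2 (I₃) p. 580; §6.2 p. 591] [cite: Shelstad1979, Lemma 4.3 (p. 25)] -/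
theorem hasOneSidedJump_bzTwistedDeriv_of_hc (S : Finset W) {w₀ : W} (hw₀ : w₀ ∉ S) (Ψ : Finset W → (W → Fin 3 → ℝ) → ℂ)
    {p : W → Fin 3 → ℝ} (hp : p w₀ 0 = p w₀ 2) {n : ℕ} (m : Fin n → W × Fin 3) {J : ℂ}
    (h : HasOneSidedJump
      (fun ν : ℝ => iteratedFDeriv ℝ n (fun c => archERho S c * Ψ S c) (p + ν • hcNrm w₀ 0 2) (fun r => hcAdaptedVec w₀ 0 2 (m r)))
      (J * hcCayScalar w₀ 0 m * iteratedFDeriv ℝ n (fun c => archERho (insert w₀ S) c * Ψ (insert w₀ S) c) (hcCayPt w₀ 0 2 p) (fun r => hcCayVec w₀ 0 2 (m r)))) :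
    HasOneSidedJump (fun ν : ℝ => bzTwistedDeriv S n (fun j => bzAdaptedVec w₀ (m j)) (Ψ S) (p + ν • nrm w₀))
      (J * bzCayScalar w₀ m * bzTwistedDeriv (insert w₀ S) n (fun j => bzCayVec (m j)) (Ψ (insert w₀ S)) (cayPt w₀ p)) := by
  have hA : (fun j => bzAdaptedVec w₀ (m j)) = fun r => hcAdaptedVec w₀ 0 2 (m r) := funext fun j => by rw [bzAdaptedVec_eq_hcAdaptedVec w₀]
  have hC : (fun j => bzCayVec (m j)) = fun r => hcCayVec w₀ 0 2 (m r) := funext fun j => by rw [bzCayVec_eq_hcCayVec w₀]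
  rw [hA, hC, bzCayScalar_eq_hcCayScalar]
  refine hasOneSidedJump_bzTwistedDeriv_of_iteratedFDeriv S hw₀ Ψ hp _ _ ?_
  rw [← hcNrm_zero_two, ← hcCayPt_zero_two]
  exact h

end Twist

section Main

variable (L : Type) [Field L] [NumberField L] [IsCMField L]
  [MeasurableSpace (↥(arch (↥(maximalRealSubfield L)) L (IsCMField.complexConj L) 2 (Matrix.of fun i j : Fin 2 => if i.val + j.val + 1 = 2 then (1 : L) else 0)) ×
      ↥(arch (↥(maximalRealSubfield L)) L (IsCMField.complexConj L) 1 (Matrix.of fun i j : Fin 1 => if i.val + j.val + 1 = 1 then (1 : L) else 0)))]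
  [BorelSpace (↥(arch (↥(maximalRealSubfield L)) L (IsCMField.complexConj L) 2 (Matrix.of fun i j : Fin 2 => if i.val + j.val + 1 = 2 then (1 : L) else 0)) ×
      ↥(arch (↥(maximalRealSubfield L)) L (IsCMField.complexConj L) 1 (Matrix.of fun i j : Fin 1 => if i.val + j.val + 1 = 1 then (1 : L) else 0)))]
  (νH : Measure (↥(arch (↥(maximalRealSubfield L)) L (IsCMField.complexConj L) 2 (Matrix.of fun i j : Fin 2 => if i.val + j.val + 1 = 2 then (1 : L) else 0)) ×
      ↥(arch (↥(maximalRealSubfield L)) L (IsCMField.complexConj L) 1 (Matrix.of fun i j : Fin 1 => if i.val + j.val + 1 = 1 then (1 : L) else 0))))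
  [IsFiniteMeasureOnCompacts νH] [νH.IsMulRightInvariant]

/-- **(JH-asm) THE (J)-H CLAUSE AT THE `G`-SEMIREGULAR WALL POINTS FROM A TWO-CHART DESCENT PACKAGE, ONE CONSTANT BEFORE THE TEST FUNCTION** (GIVEN-form).
Data before `fH`: the rank-one carrier `U(J)` (`hJ`), a Haar `μ` (elliptic reader `Φ₁`, centre `1`), an Iwasawa datum `(K, κK, μN)` (split half-chart reader `Φ₂`, angle `0`), a smooth
cofactor `Pf` and two non-zero constants `K₁, K₂`.  Socket `hdesc` (per `fH ∈ C_c^∞(H_∞)` and per semiregular wall point `p` of the wall `(w₀, 0, 2)`): an admissible family `G` and the two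
descent identities — `archERho S · stOrbFamH S = K₁ · Pf(π c) · Φ₁^{st}(G(π c))(ν c)` off the wall near `p` (STABLE reader `Φ₁^{st} f ψ = Φ₁ f ψ − Φ₁ f (−ψ)`), and
`archERho S′ · stOrbFamH S′ = K₂ · Pf(ĉ″) · Φ₂(G ĉ″)(x c″)` near the Cayley point.  Conclusion: ONE `J ≠ 0` (`= (K₁∕K₂)·2κ₀`, `κ₀` of ★ (st-1)) serving ★ (π)'s `G`-semiregular clause
for `stOrbFamH L νH fH`, EVERY `fH`, all orders, all adapted words — the body of ★ `exists_archBouazizSpaceH_stOrbFamH`'s socket `hsemi` at `(S, w₀)`.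
[cite: Bouaziz1994IntegralesOrbitales, §3.2 (I₃) p. 580; §6.2 p. 591] [cite: Shelstad1979, Lemma 4.3 (p. 25), Prop. 4.5 (p. 26), Thm. 4.7 (IIIb) (p. 31)] [cite: Varadarajan1977, I §1.12] -/
theorem exists_jumpConst_stOrbFamH_of_twoChartDescent (S : Finset {w : InfinitePlace L // IsComplex w}) (w₀ : {w : InfinitePlace L // IsComplex w}) (hw₀ : w₀ ∉ S)
    {J : Matrix (Fin 2) (Fin 2) ℂ} (hJ : J = (StdForm.antidiagonal 2).over ℂ)
    [MeasurableSpace ↥(unitaryGroupOfForm (starRingEnd ℂ) J)] [BorelSpace ↥(unitaryGroupOfForm (starRingEnd ℂ) J)]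
    (μ : Measure ↥(unitaryGroupOfForm (starRingEnd ℂ) J)) [μ.IsHaarMeasure] [μ.IsMulRightInvariant]
    {K : Subgroup ↥(unitaryGroupOfForm (starRingEnd ℂ) J)} (κK : Measure ↥K) (μN : Measure ↥(unipotentU (starRingEnd ℂ) J))
    (hK : IsCompact (K : Set ↥(unitaryGroupOfForm (starRingEnd ℂ) J)))
    (hKB : ∀ g : ↥(unitaryGroupOfForm (starRingEnd ℂ) J), ∃ k ∈ K, ∃ b ∈ borelU (starRingEnd ℂ) J, g = k * b) [κK.IsHaarMeasure] [μN.IsHaarMeasure]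
    (Φ₁ : (Matrix (Fin 2) (Fin 2) ℂ → ℂ) → ℝ → ℂ)
    (hΦ₁ : ∀ (f : Matrix (Fin 2) (Fin 2) ℂ → ℂ) (ψ : ℝ), Φ₁ f ψ = (2 * Real.sin ψ) •
      ∫ h : ↥(unitaryGroupOfForm (starRingEnd ℂ) J), f (((h * ⟨Matrix.GeneralLinearGroup.mkOfDetNeZero !![(1 : ℂ), 1; 1, -1] det_cayleyTwo_ne_zero *
            circleDiagonal 2 ![1 * Circle.exp ψ, 1 * Circle.exp (-ψ)] * (Matrix.GeneralLinearGroup.mkOfDetNeZero !![(1 : ℂ), 1; 1, -1] det_cayleyTwo_ne_zero)⁻¹,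
          cayley_conj_circleDiagonal_mem_of_eq_over hJ _⟩ * h⁻¹ : ↥(unitaryGroupOfForm (starRingEnd ℂ) J)) : GL (Fin 2) ℂ) : Matrix (Fin 2) (Fin 2) ℂ) ∂μ)
    (Φ₂ : (Matrix (Fin 2) (Fin 2) ℂ → ℂ) → ℝ → ℂ)
    (hΦ₂ : ∀ (f : Matrix (Fin 2) (Fin 2) ℂ → ℂ) (x : ℝ), Φ₂ f x = ∫ p : ↥K × ↥(unipotentU (starRingEnd ℂ) J),
      f ((((((p.1 : ↥K) : ↥(unitaryGroupOfForm (starRingEnd ℂ) J)) * (((⟨hypBlockGL 0 0, hypBlockGL_mem_of_eq_over hJ 0 0⟩ : ↥(unitaryGroupOfForm (starRingEnd ℂ) J))) *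
          ((⟨hypBlockGL (x / 2) 0, hypBlockGL_mem_of_eq_over hJ (x / 2) 0⟩ : ↥(unitaryGroupOfForm (starRingEnd ℂ) J))) *
          ((p.2 : ↥(unipotentU (starRingEnd ℂ) J)) : ↥(unitaryGroupOfForm (starRingEnd ℂ) J)) *
          ((⟨hypBlockGL (x / 2) 0, hypBlockGL_mem_of_eq_over hJ (x / 2) 0⟩ : ↥(unitaryGroupOfForm (starRingEnd ℂ) J)))) *
          ((p.1 : ↥K) : ↥(unitaryGroupOfForm (starRingEnd ℂ) J))⁻¹ : ↥(unitaryGroupOfForm (starRingEnd ℂ) J))) : GL (Fin 2) ℂ) : Matrix (Fin 2) (Fin 2) ℂ) ∂(κK.prod μN))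
    (Pf : ({w : InfinitePlace L // IsComplex w} → Fin 3 → ℝ) → ℂ) (K₁ K₂ : ℂ) (hK₁ : K₁ ≠ 0) (hK₂ : K₂ ≠ 0)
    (hdesc : ∀ fH : ↥(arch (↥(maximalRealSubfield L)) L (IsCMField.complexConj L) 2 (Matrix.of fun i j : Fin 2 => if i.val + j.val + 1 = 2 then (1 : L) else 0)) ×
          ↥(arch (↥(maximalRealSubfield L)) L (IsCMField.complexConj L) 1 (Matrix.of fun i j : Fin 1 => if i.val + j.val + 1 = 1 then (1 : L) else 0)) → ℂ,
        ArchSmooth₂ L fH → ∀ p : {w : InfinitePlace L // IsComplex w} → Fin 3 → ℝ, HcSemireg S w₀ 0 2 p →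
        ∃ (U₁ U₂ : Set ({w : InfinitePlace L // IsComplex w} → Fin 3 → ℝ)) (G : ({w : InfinitePlace L // IsComplex w} → Fin 3 → ℝ) → Matrix (Fin 2) (Fin 2) ℂ → ℂ),
          IsOpen U₁ ∧ p ∈ U₁ ∧ IsOpen U₂ ∧ hcCayPt w₀ 0 2 p ∈ U₂ ∧ ContDiff ℝ ∞ (Function.uncurry G) ∧
          (∃ C : Set (Matrix (Fin 2) (Fin 2) ℂ), IsCompact C ∧ ∀ (q : {w : InfinitePlace L // IsComplex w} → Fin 3 → ℝ) (X : Matrix (Fin 2) (Fin 2) ℂ), X ∉ C → G q X = 0) ∧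
          ContDiff ℝ ∞ Pf ∧
          (∀ c ∈ U₁, ((c w₀ 0 - c w₀ 2) / 2) ∈ {ψ : ℝ | Real.sin ψ ≠ 0} →
            archERho S c * stOrbFamH L νH fH S c =
              K₁ * ((1 : ℂ) * Pf (c - ((c w₀ 0 - c w₀ 2) / 2) • hcNrm w₀ 0 2) - 0) *
                (Φ₁ (G (c - ((c w₀ 0 - c w₀ 2) / 2) • hcNrm w₀ 0 2)) ((c w₀ 0 - c w₀ 2) / 2) -
                  Φ₁ (G (c - ((c w₀ 0 - c w₀ 2) / 2) • hcNrm w₀ 0 2)) (-((c w₀ 0 - c w₀ 2) / 2)))) ∧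
          (∀ c ∈ U₂,
            archERho (insert w₀ S) c * stOrbFamH L νH fH (insert w₀ S) c =
              K₂ * ((1 : ℂ) * Pf (Function.update c w₀ (fun s => if s = hcThird 0 2 then c w₀ 1 else c w₀ 2)) - 0) *
                Φ₂ (G (Function.update c w₀ (fun s => if s = hcThird 0 2 then c w₀ 1 else c w₀ 2))) (c w₀ 0))) :
    ∃ Jc : ℂ, Jc ≠ 0 ∧
      ∀ fH : ↥(arch (↥(maximalRealSubfield L)) L (IsCMField.complexConj L) 2 (Matrix.of fun i j : Fin 2 => if i.val + j.val + 1 = 2 then (1 : L) else 0)) ×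
          ↥(arch (↥(maximalRealSubfield L)) L (IsCMField.complexConj L) 1 (Matrix.of fun i j : Fin 1 => if i.val + j.val + 1 = 1 then (1 : L) else 0)) → ℂ,
        ArchSmooth₂ L fH →
        ∀ p : {w : InfinitePlace L // IsComplex w} → Fin 3 → ℝ, p w₀ 0 = p w₀ 2 →
        Circle.exp (p w₀ 1) ≠ Circle.exp (p w₀ 0) →
        (∀ v, v ∉ S → v ≠ w₀ → Function.Injective fun i : Fin 3 => Circle.exp (p v i)) →
        (∀ v ∈ S, p v 0 ≠ 0) →
        ∀ (n : ℕ) (m : Fin n → {w : InfinitePlace L // IsComplex w} × Fin 3),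
          HasOneSidedJump (fun ν : ℝ => bzTwistedDeriv S n (fun j => bzAdaptedVec w₀ (m j)) (stOrbFamH L νH fH S) (p + ν • nrm w₀))
            (Jc * bzCayScalar w₀ m * bzTwistedDeriv (insert w₀ S) n (fun j => bzCayVec (m j)) (stOrbFamH L νH fH (insert w₀ S)) (cayPt w₀ p)) := by
  haveI : Fact (0 < 2 * Real.pi) := ⟨Real.two_pi_pos⟩
  -- ★ (st-1): ONE `κ₀ > 0` for the odd-ised elliptic reader against the split reader, all test functions, all orders
  obtain ⟨κ₀, hκ₀, hst1⟩ := exists_hasOneSidedJump_iteratedDeriv_allOrders_chart_stable_of_eq_over L w₀ hJ μ κK μN hK hKB _ (fun _ _ => rfl)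
  refine ⟨K₁ / K₂ * (((2 * κ₀ : ℝ)) : ℂ), mul_ne_zero (div_ne_zero hK₁ hK₂) (by exact_mod_cast (by positivity : (2 * κ₀ : ℝ) ≠ 0)),
    fun fH hfH p hp02 hp1 hinj hx n m => ?_⟩
  have hp : HcSemireg S w₀ 0 2 p := hcSemireg_zero_two_of_gSemireg S w₀ hp02 hp1 hinj hx
  obtain ⟨U₁, U₂, G, hU₁, hpU₁, hU₂, hpU₂, hG, hGc, hPf, hd₁, hd₂⟩ := hdesc fH hfH p hp
  -- ★ 4d's reading of the elliptic reader (complex multiplication, centre `Circle.exp 0 = 1`)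
  have hΦ₁' : ∀ (f : Matrix (Fin 2) (Fin 2) ℂ → ℂ) (ψ : ℝ), Φ₁ f ψ = (2 * Real.sin ψ : ℂ) *
      ∫ h : ↥(unitaryGroupOfForm (starRingEnd ℂ) J), f (((h * (⟨(Matrix.GeneralLinearGroup.mkOfDetNeZero !![(1 : ℂ), 1; 1, -1] det_cayleyTwo_ne_zero) *
            circleDiagonal 2 ![Circle.exp 0 * Circle.exp ψ, Circle.exp 0 * Circle.exp (-ψ)] * ((Matrix.GeneralLinearGroup.mkOfDetNeZero !![(1 : ℂ), 1; 1, -1] det_cayleyTwo_ne_zero))⁻¹,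
          cayley_conj_circleDiagonal_mem_of_eq_over hJ _⟩ : ↥(unitaryGroupOfForm (starRingEnd ℂ) J)) * h⁻¹ : ↥(unitaryGroupOfForm (starRingEnd ℂ) J)) : GL (Fin 2) ℂ) :
        Matrix (Fin 2) (Fin 2) ℂ) ∂μ := fun f ψ => by
    rw [hΦ₁, Complex.real_smul, Complex.ofReal_mul, Complex.ofReal_ofNat]
    simp only [Circle.exp_zero]
  -- the punctured normal interval `T₁ = {sin ψ ≠ 0}`
  have hT₁ : IsOpen {ψ : ℝ | Real.sin ψ ≠ 0} := isOpen_ne_fun Real.continuous_sin continuous_const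
  have hrayT : ∀ᶠ t : ℝ in 𝓝[≠] 0, t ∈ {ψ : ℝ | Real.sin ψ ≠ 0} := by
    have hI : Set.Ioo (-Real.pi) Real.pi ∈ 𝓝 (0 : ℝ) := Ioo_mem_nhds (neg_lt_zero.2 Real.pi_pos) Real.pi_pos
    filter_upwards [mem_nhdsWithin_of_mem_nhds hI, self_mem_nhdsWithin] with t ht ht0
    intro hsin
    exact ht0 ((Real.sin_eq_zero_iff_of_lt_of_lt ht.1 ht.2).1 hsin)
  -- the junction for EVERY admissible family at `p`, ONE `2κ₀` (★ (st-1))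
  have hjumpAll : ∀ g' : ({w : InfinitePlace L // IsComplex w} → Fin 3 → ℝ) → Matrix (Fin 2) (Fin 2) ℂ → ℂ,
      (ContDiff ℝ ∞ (Function.uncurry g') ∧ ∃ C : Set (Matrix (Fin 2) (Fin 2) ℂ), IsCompact C ∧
        ∀ (q : {w : InfinitePlace L // IsComplex w} → Fin 3 → ℝ) (X : Matrix (Fin 2) (Fin 2) ℂ), X ∉ C → g' q X = 0) →
      ∀ a : ℕ, HasOneSidedJump (fun t : ℝ => iteratedDeriv a (fun t : ℝ => Φ₁ (g' p) t - Φ₁ (g' p) (-t)) t)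
        ((((2 * κ₀ : ℝ)) : ℂ) * I ^ a * iteratedDeriv a (Φ₂ (g' p)) 0) := by
    rintro g' ⟨h1, C, hC, h0⟩ a
    have hs : ContDiff ℝ ∞ (g' p) := h1.comp (contDiff_const.prodMk contDiff_id)
    have hcs : HasCompactSupport (g' p) := HasCompactSupport.intro hC (fun X hX => h0 p X hX)
    exact hst1 (g' p) hs hcs 0 Φ₁ hΦ₁' Φ₂ hΦ₂ a
  -- trivial cofactors: `ce = ch := 1`, `Ef := 0`, Wick input automatic
  have hwick : ∀ a : ℕ, iteratedDeriv a (fun _ : ℝ => (1 : ℂ)) 0 = I ^ a * iteratedDeriv a (fun _ : ℝ => (1 : ℂ)) 0 := by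
    intro a
    rcases Nat.eq_zero_or_pos a with h0 | hpos
    · subst h0; simp
    · rw [iteratedDeriv_const, if_neg hpos.ne', mul_zero]
  -- the two genuine families and the descent identities in ★ (st-2)'s token shapes
  obtain ⟨F₁, hF₁⟩ : ∃ F₁ : ({w : InfinitePlace L // IsComplex w} → Fin 3 → ℝ) → ℂ, F₁ = fun c => archERho S c * stOrbFamH L νH fH S c := ⟨_, rfl⟩
  obtain ⟨F₂, hF₂⟩ : ∃ F₂ : ({w : InfinitePlace L // IsComplex w} → Fin 3 → ℝ) → ℂ,
      F₂ = fun c => archERho (insert w₀ S) c * stOrbFamH L νH fH (insert w₀ S) c := ⟨_, rfl⟩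
  have hdesc₁ : ∀ c ∈ U₁, (c w₀ 0 - c w₀ 2) / 2 ∈ {ψ : ℝ | Real.sin ψ ≠ 0} →
      F₁ c = K₁ * ((fun _ : ℝ => (1 : ℂ)) ((c w₀ 0 - c w₀ 2) / 2) * Pf (c - ((c w₀ 0 - c w₀ 2) / 2) • hcNrm w₀ 0 2) -
          (fun _ : {w : InfinitePlace L // IsComplex w} → Fin 3 → ℝ => (0 : ℂ)) (c - ((c w₀ 0 - c w₀ 2) / 2) • hcNrm w₀ 0 2)) *
        (Φ₁ (G (c - ((c w₀ 0 - c w₀ 2) / 2) • hcNrm w₀ 0 2)) ((c w₀ 0 - c w₀ 2) / 2) -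
          Φ₁ (G (c - ((c w₀ 0 - c w₀ 2) / 2) • hcNrm w₀ 0 2)) (-((c w₀ 0 - c w₀ 2) / 2))) := by
    intro c hc hs
    rw [hF₁]
    exact hd₁ c hc hs
  have hdesc₂ : ∀ c ∈ U₂,
      F₂ c = K₂ * ((fun _ : ℝ => (1 : ℂ)) (c w₀ 0) * Pf (Function.update c w₀ (fun s => if s = hcThird 0 2 then c w₀ 1 else c w₀ 2)) -
          (fun _ : {w : InfinitePlace L // IsComplex w} → Fin 3 → ℝ => (0 : ℂ)) (Function.update c w₀ (fun s => if s = hcThird 0 2 then c w₀ 1 else c w₀ 2))) *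
        Φ₂ (G (Function.update c w₀ (fun s => if s = hcThird 0 2 then c w₀ 1 else c w₀ 2))) (c w₀ 0) := by
    intro c hc
    rw [hF₂]
    exact hd₂ c hc
  -- ★ (st-2)
  have key := hasOneSidedJump_iteratedFDeriv_adaptedWord_of_twoChart_orbital_stable w₀ (show (0 : Fin 3) ≠ 2 by decide) hJ μ 1
    Φ₁ hΦ₁ κK μN hK 0 Φ₂ hΦ₂ hT₁ (fun _ h => h) hrayT isOpen_univ G hG hGc Pf (fun _ => (0 : ℂ)) hPf.contDiffOn contDiffOn_const
    (fun _ : ℝ => (1 : ℂ)) (fun _ : ℝ => (1 : ℂ)) contDiff_const contDiff_const hwick K₁ K₂ (((2 * κ₀ : ℝ)) : ℂ) hK₂ hp.1 (Set.mem_univ p) F₁ F₂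
    hU₁ hpU₁ hU₂ hpU₂ hdesc₁ hdesc₂ hjumpAll n m
  -- back to Bouaziz's currency (§1)
  rw [hF₁, hF₂] at key
  exact hasOneSidedJump_bzTwistedDeriv_of_hc S hw₀ (stOrbFamH L νH fH) hp02 m key

end Main

end Literature.NumberTheory.Rogawski1990

end
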